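import Literature.IUT.LogVolume.GenuineTowerFactsSharp
import Literature.IUT.LogVolume.SubThetaFieldRamificationSixty
import Literature.IUT.LogVolume.InitialThetaDataBadPlaceRamification
import Literature.IUT.LogVolume.GenuineLogThetaPointNecessity
import Literature.IUT.LogVolume.GenuineRamificationBounds
import Literature.NumberTheory.DiophantineGeometry.AbcWave0UniformABCProofs
import Literature.NumberTheory.EllipticCurves.Fisher2016.CongruentKummerConditions
import HarnessLib

/-!
# The LOCAL TYPE of the `l`-division tower of a genuine Θ-volume datum at a bad place away from `2·3·5·l`:
# `e(u | v_tpd) ∣ 60·l` (abc-iut R-W window table, finding F1-4 «LOCAL-TYPE LEMMA»; proof-only)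

Mochizuki, *Inter-universal Teichmüller theory IV* (RIMS manuscript Apr. 2020 = PRIMS **57** (2021)), Thm. 1.10,
Steps (ii)–(iii) p. 24–26 (the tower `ℚ ⊆ F_tpd ⊆ F ⊆ K = F(E_F[l])` of a collection of initial Θ-data and its
per-layer ramification budget); [IUTchI] Ex. 3.2 (iv) p. 71 (at a bad place `K_w ⊇ F_v(q_v^{1/l})`); J.-P. Serre,
*Propriétés galoisiennes des points d'ordre fini des courbes elliptiques*, Invent. Math. **15** (1972), §1.11–§1.12.

For a genuine Θ-volume datum `T : Cor22.ThetaVolumeDatumAt P l` (abc-iut-S2's `GenuineLogThetaPoint.lean`; `λ ∈ U_X` is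
read off the datum by `ThetaVolumeDatumAt.inU`) and a place `u` of `K = T.K` of residue characteristic
`p ∉ {2, 3, 5, l}` lying over a BAD place `v₀` of `λ` (`ord_{v₀} j(λ) < 0`):

* the `K/F` layer `e(u | w) ∣ l` (`w = u ∩ F`, `p_u ≠ l`) is abc-iut-S-d1's `ThetaVolumeDatumAt.ramificationIdx_dvd_prime`
  (`GenuineTowerFactsSharp.lean`, [IUTchIV] Prop. 1.8 (vii)), consumed BY NAME;
* `ThetaVolumeDatumAt.ramificationIdx_tpd_F_dvd_sixty` — `e(w | v₀) ∣ 60` for the datum's `F/F_tpd` at a bad `v₀ ∤ 30`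
  (this seat's `Cor22.ramificationIdx_subThetaField_dvd_sixty`: inertia fixes `√−1` and the even twist root, acts on
  `E_λ[3]`, `E_λ[5]` unipotently up to the twist character);
* **`ThetaVolumeDatumAt.ramificationIdx_int_dvd_sixty_mul`** — `e(u | p) ∣ e(v₀ | p) · 60 · l`;
* **`ThetaVolumeDatumAt.ramificationIdx_int_dvd_sixty_mul_ratPoint`** — at a rational point (`F_tpd = ℚ`, `e(v₀|p) = 1`):
  **`e(u | p) ∣ 60 · l`** for every place `u` of `K` of residue characteristic `p ∉ {2,3,5,l}` with `ord_p j(λ) < 0`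
  (`e(v₀ | p) = 1` over `ℚ`: the tree's `Fisher2016.ramificationIdx_int_rat_eq_one`).

So the completion `K_u` is TAME over `ℚ_p` with ramification index a divisor of `60·l` — the «local type» that
decides the [IUTchIV] Prop. 1.2 constants `(d, a, b)` of `K_u` (abc-iut rw-num-lead, WINDOW-TABLE v1 finding F1-4;
consumer: the explicit-depth refutation engine `GenuineK.not_pilotKummerCompatHull_chosen_of_explicit_depth`).
Proof-only (no definition, no named fact); inputs BY NAME (`towerFacts`, `ThetaVolumeDatumAt.ramificationIdx_dvd_prime`,
`ThetaData.absRamificationIdx_eq_ramIdx_mul`); classical; TAKES NO SIDE on [IUTchIII] Cor. 3.12.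
[cite: Mochizuki2012, IUTchIV Thm. 1.10 proof Steps (ii)–(iii) p. 24–26] [cite: Mochizuki2012, IUTchI Ex. 3.2 (iv) p. 71]
[claim: Mochizuki2012, status: disputed] for every IUT quotation.
-/

noncomputable section

open scoped Classical

namespace Literature.IUT.LogVolume

namespace Cor22

open NumberField IsDedekindDomain Literature.NumberTheory.DiophantineGeometry.GenEll
open Literature.NumberTheory.EllipticCurves Literature.NumberTheory.NumberFields Literature.IUT.HodgeTheaters
open WeierstrassCurve IntermediateField Field

/-! ## At a genuine Θ-volume datum -/

namespace ThetaVolumeDatumAt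

variable {P : NFPoint} {l : ℕ} (T : ThetaVolumeDatumAt P l)

/-- **`F/F_tpd` layer of a genuine Θ-volume datum: `e(w | w ∩ F_tpd) ∣ 60`** at every place `w` of `F` of residue
characteristic `∉ {2, 3, 5}` over a BAD place of `λ` (this seat's `ramificationIdx_subThetaField_dvd_sixty` for the
datum's field, Galois over `F_tpd` by `towerFacts`). [cite: Mochizuki2012, IUTchIV Thm. 1.10 proof Step (iii) (R2)–(R4) p. 25–26]
[claim: Mochizuki2012, status: disputed] -/
theorem ramificationIdx_tpd_F_dvd_sixty
    (w : letI := T.instFieldF; letI := T.instNumberFieldF; HeightOneSpectrum (𝓞 T.F))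
    (hw : letI := T.instFieldF; letI := T.instNumberFieldF; residueChar T.F w ∉ ({2, 3, 5} : Finset ℕ))
    (hbad : letI := T.instFieldF; letI := T.instNumberFieldF; letI := T.instAlgebraF
      finBelow P.F T.F w ∈ badPlaces P) :
    (letI := T.instFieldF; letI := T.instNumberFieldF; letI := T.instAlgebraF
     w.asIdeal.ramificationIdx (𝓞 P.F)) ∣ 60 := by
  letI := T.instFieldF; letI := T.instNumberFieldF; letI := T.instAlgebraF; letI := T.instFieldK
  letI := T.instNumberFieldK; letI := T.instAlgebraK; letI := T.instFieldFbar; letI := T.instAlgebraFbar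
  letI := T.instAlgebraKFbar; letI := T.instIsElliptic
  haveI : IsGalois P.F T.F := (T.towerFacts T.inU).1
  exact ramificationIdx_subThetaField_dvd_sixty T.F T.inU T.isSubThetaField w hbad
    (thirty_notMem_finBelow_of_residueChar_notMem w hw)

/-- **THE LOCAL TYPE: `e(u | p) ∣ e(v₀ | p) · 60 · l`** for every place `u` of the `l`-division field `K` of a genuine
Θ-volume datum, of residue characteristic `p ∉ {2, 3, 5, l}`, over a BAD place `v₀ = u ∩ F_tpd` of `λ`
(`e(u|p) = e(v₀|p)·e(w|v₀)·e(u|w)` in the tower `ℤ ⊆ 𝓞_{F_tpd} ⊆ 𝓞_F ⊆ 𝓞_K`, Neukirch II (6.8)).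
[cite: Mochizuki2012, IUTchIV Thm. 1.10 proof Steps (ii)–(iii) p. 24–26] [cite: NeukirchANT1999, Ch. II Prop. (6.8)]
[claim: Mochizuki2012, status: disputed] -/
theorem ramificationIdx_int_dvd_sixty_mul
    (u : letI := T.instFieldK; letI := T.instNumberFieldK; HeightOneSpectrum (𝓞 T.K))
    (hu : letI := T.instFieldK; letI := T.instNumberFieldK; residueChar T.K u ∉ ({2, 3, 5, l} : Finset ℕ))
    (hbad : letI := T.instFieldF; letI := T.instNumberFieldF; letI := T.instAlgebraF; letI := T.instFieldK
      letI := T.instNumberFieldK; letI := T.instAlgebraK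
      finBelow P.F T.F (finBelow T.F T.K u) ∈ badPlaces P) :
    (letI := T.instFieldK; letI := T.instNumberFieldK
     u.asIdeal.ramificationIdx ℤ) ∣
      (letI := T.instFieldF; letI := T.instNumberFieldF; letI := T.instAlgebraF; letI := T.instFieldK
       letI := T.instNumberFieldK; letI := T.instAlgebraK
       (finBelow P.F T.F (finBelow T.F T.K u)).asIdeal.ramificationIdx ℤ) * 60 * l := by
  letI := T.instFieldF; letI := T.instNumberFieldF; letI := T.instAlgebraF; letI := T.instFieldK
  letI := T.instNumberFieldK; letI := T.instAlgebraK; letI := T.instFieldFbar; letI := T.instAlgebraFbar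
  letI := T.instAlgebraKFbar; letI := T.instIsElliptic
  simp only [Finset.mem_insert, Finset.mem_singleton, not_or] at hu
  obtain ⟨h2, h3, h5, hul⟩ := hu
  set w := finBelow T.F T.K u with hwdef
  set v₀ := finBelow P.F T.F w with hv₀def
  have hw : residueChar T.F w ∉ ({2, 3, 5} : Finset ℕ) := by
    rw [hwdef, residueChar_finBelow]
    simp only [Finset.mem_insert, Finset.mem_singleton, not_or]
    exact ⟨h2, h3, h5⟩
  have hKF : u.asIdeal.ramificationIdx (𝓞 T.F) ∣ l := T.ramificationIdx_dvd_prime u hul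
  have hFtpd : w.asIdeal.ramificationIdx (𝓞 P.F) ∣ 60 := T.ramificationIdx_tpd_F_dvd_sixty w hw hbad
  -- `e(u|p) = e(v₀|p)·e(w|v₀)·e(u|w)`
  have hw_under : u.under (𝓞 T.F) = w := rfl
  have hv_under : w.under (𝓞 P.F) = v₀ := rfl
  haveI : w.asIdeal.IsMaximal := w.isMaximal
  haveI : v₀.asIdeal.IsMaximal := v₀.isMaximal
  have heuw : Ideal.ramificationIdx' w.asIdeal u.asIdeal = u.asIdeal.ramificationIdx (𝓞 T.F) :=
    Ideal.ramificationIdx'_eq_ramificationIdx w.asIdeal u.asIdeal w.ne_bot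
  have hewv : Ideal.ramificationIdx' v₀.asIdeal w.asIdeal = w.asIdeal.ramificationIdx (𝓞 P.F) :=
    Ideal.ramificationIdx'_eq_ramificationIdx v₀.asIdeal w.asIdeal v₀.ne_bot
  have heu : u.asIdeal.ramificationIdx ℤ =
      v₀.asIdeal.ramificationIdx ℤ * w.asIdeal.ramificationIdx (𝓞 P.F) * u.asIdeal.ramificationIdx (𝓞 T.F) := by
    rw [ThetaData.absRamificationIdx_eq_ramIdx_mul (F := T.F) u, hw_under,
      ramIdx_eq, ThetaData.absRamificationIdx_eq_ramIdx_mul (F := P.F) w, hv_under, ramIdx_eq, heuw, hewv]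
  rw [heu]
  exact mul_dvd_mul (mul_dvd_mul dvd_rfl hFtpd) hKF

/-- **At a RATIONAL point (`F_tpd = ℚ`): `e(u | p) ∣ 60 · l`** for every place `u` of the `l`-division field `K` of a
genuine Θ-volume datum at `(ratPoint q, l)`, of residue characteristic `p ∉ {2, 3, 5, l}`, lying over a pole of
`j(q)` (`ord_p j(q) < 0`). The LOCAL-TYPE LEMMA of the abc-iut R-W window table (rw-num-lead F1-4) in place form:
`K_u/ℚ_p` is tame of ramification index dividing `60·l`. [cite: Mochizuki2012, IUTchIV Thm. 1.10 proof Steps (ii)–(iii) p. 24–26]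
[cite: Serre1972, §1.11–§1.12] [claim: Mochizuki2012, status: disputed] -/
theorem ramificationIdx_int_dvd_sixty_mul_ratPoint {q : ℚ} {l : ℕ} (T : ThetaVolumeDatumAt (ratPoint q) l)
    (u : letI := T.instFieldK; letI := T.instNumberFieldK; HeightOneSpectrum (𝓞 T.K))
    (hu : letI := T.instFieldK; letI := T.instNumberFieldK; residueChar T.K u ∉ ({2, 3, 5, l} : Finset ℕ))
    (hbad : letI := T.instFieldF; letI := T.instNumberFieldF; letI := T.instAlgebraF; letI := T.instFieldK
      letI := T.instNumberFieldK; letI := T.instAlgebraK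
      finBelow (ratPoint q).F T.F (finBelow T.F T.K u) ∈ badPlaces (ratPoint q)) :
    (letI := T.instFieldK; letI := T.instNumberFieldK
     u.asIdeal.ramificationIdx ℤ) ∣ 60 * l := by
  letI := T.instFieldF; letI := T.instNumberFieldF; letI := T.instAlgebraF; letI := T.instFieldK
  letI := T.instNumberFieldK; letI := T.instAlgebraK
  have h := T.ramificationIdx_int_dvd_sixty_mul u hu hbad
  have h1 : (finBelow (ratPoint q).F T.F (finBelow T.F T.K u)).asIdeal.ramificationIdx ℤ = 1 :=
    Literature.NumberTheory.EllipticCurves.Fisher2016.ramificationIdx_int_rat_eq_one _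
  rw [h1, one_mul] at h
  exact h

/-- The same with the bad place given by its residue characteristic: at a rational point, if `u` has residue
characteristic `p ∉ {2, 3, 5, l}` and EVERY place of `ℚ` over `p` is a pole of `j(q)` (i.e. `ord_p j(q) < 0`, stated
through the place `v` of `ℚ` with `natGenerator v = p`), then `e(u | p) ∣ 60 · l`.
[cite: Mochizuki2012, IUTchIV Thm. 1.10 proof Steps (ii)–(iii) p. 24–26] [claim: Mochizuki2012, status: disputed] -/
theorem ramificationIdx_int_dvd_sixty_mul_ratPoint' {q : ℚ} {l : ℕ} (T : ThetaVolumeDatumAt (ratPoint q) l)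
    {p : ℕ} (hp : p ∉ ({2, 3, 5, l} : Finset ℕ))
    (hpole : ∀ v : HeightOneSpectrum (𝓞 ℚ), Rat.HeightOneSpectrum.natGenerator v = p →
      ord ℚ v (jInv q) < 0)
    (u : letI := T.instFieldK; letI := T.instNumberFieldK; HeightOneSpectrum (𝓞 T.K))
    (hu : letI := T.instFieldK; letI := T.instNumberFieldK; residueChar T.K u = p) :
    (letI := T.instFieldK; letI := T.instNumberFieldK
     u.asIdeal.ramificationIdx ℤ) ∣ 60 * l := by
  letI := T.instFieldF; letI := T.instNumberFieldF; letI := T.instAlgebraF; letI := T.instFieldK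
  letI := T.instNumberFieldK; letI := T.instAlgebraK
  refine T.ramificationIdx_int_dvd_sixty_mul_ratPoint u (by rw [hu]; exact hp) ?_
  set v : HeightOneSpectrum (𝓞 ℚ) := finBelow (ratPoint q).F T.F (finBelow T.F T.K u) with hvdef
  have hvp : Rat.HeightOneSpectrum.natGenerator v = p := by
    have hchar : residueChar ℚ v = p := by
      rw [hvdef]
      change residueChar (ratPoint q).F (finBelow (ratPoint q).F T.F (finBelow T.F T.K u)) = p
      rw [residueChar_finBelow, residueChar_finBelow, hu]
    have hpp : p.Prime := hchar ▸ residueChar_prime ℚ v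
    have hmem : ((p : ℕ) : 𝓞 ℚ) ∈ v.asIdeal := by
      rw [natCast_mem_asIdeal_iff_residueChar_eq v hpp]; exact hchar
    have hdvd := (Literature.NumberTheory.DiophantineGeometry.UniformABCConjecture.natCast_mem_asIdeal_iff v p).1 hmem
    exact (Nat.prime_dvd_prime_iff_eq (Rat.HeightOneSpectrum.prime_natGenerator v) hpp).1 hdvd
  exact (mem_badPlaces_iff_ord_neg (ratPoint q) v).2 (hpole v hvp)

end ThetaVolumeDatumAt

end Cor22

end Literature.IUT.LogVolume

end
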